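import Summits.QuantumFields.GaugeBoot.DiagonalRPTorusOddStaircase
import Summits.QuantumFields.GaugeBoot.DiagonalRPCutIntegral
import HarnessLib

/-!
# Staircase witness on the odd two-torus: continuity, the far layers, and the one-link identity
(gauge-boot, L3(θ) gauge-invariant sector at `β < 0`, 2a/3)

HONEST FRAMING (cell `pub-gaugeboot`, page 1 of every file): the venture produces certified bounds
on lattice expectations at stated coupling, gauge group, dimension and torus size; NOT a mass gap,
NOT a continuum limit, NOT a string tension; NOT Yang–Mills-summit-bearing (barriers
`FixedCouplingUltralocality`, `PerturbativeInvisibility`). Plumbing for the NEGATIVE structural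
result `DiagonalRPTorusOddGaugeInvariantNegative.lean`; no number is certified.

## Content (notation of `DiagonalRPTorusOddStaircase`)

* continuity / boundedness / measurability of the staircase holonomies and of the witness
  `stairWitness` (`measurable_stairWitness`, `exists_norm_stairWitness_le`);
* `layerW_update_dgj`, `layerW_configDiagSwap_update_dgj` — for `L ≥ 5` the far-layer weight
  `A = layerW` and its swap `A∘Θ` do not read the mirror `j`-links `(dg k, j)` (the layers `c`,
  `c + 1` of the odd torus `L = 2c+1` stay at distance `≥ 2` from the mirror);
* ★ `integral_conj_trace_mul_weight` — THE ONE-LINK IDENTITY: for a continuous weight `w` with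
  `wAvg ρ w = c • 1` and all `X u Y C ∈ G`,
  `∫ conj tr ρ(X (s u) Y) · w(C (s u)⁻¹) ds = c · conj tr ρ(X C Y)`
  (two-sided and inversion invariance of Haar measure + the tree's
  `DiagRP.integral_weight_mul_trace_mul`).

Elementary. [folklore]
-/

open MeasureTheory Complex Finset Function
open scoped ComplexOrder

namespace Summit.QuantumFields.GaugeBoot

open Literature.MathematicalPhysics.QuantumFieldTheory
open Literature.RepresentationTheory.CompactGroups

noncomputable section

namespace DiagRPTwo

/-! ## Continuity -/

section Continuity

variable {L N : ℕ} {G : Type*} [Group G] [TopologicalSpace G] [IsTopologicalGroup G]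
  (ρ : G →* Matrix (Fin N) (Fin N) ℂ) {i j : Fin 2}

/-- The mirror transports are continuous. -/
theorem continuous_cT (y : Site 2 L) : Continuous fun U : GaugeConfig 2 L G => cT i j U y :=
  (continuous_apply _).mul (continuous_apply _)

/-- The mirrored transports are continuous. -/
theorem continuous_dT (y : Site 2 L) : Continuous fun U : GaugeConfig 2 L G => dT i j U y :=
  (continuous_apply _).mul (continuous_apply _)

/-- The staircase is continuous. -/
theorem continuous_stairC (n : ℕ) : Continuous fun U : GaugeConfig 2 L G => stairC i j n U := by
  induction n with
  | zero => simp only [stairC_zero]; exact continuous_const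
  | succ n ih => simp only [stairC_succ]; exact ih.mul (continuous_cT _)

/-- The mixed staircase is continuous. -/
theorem continuous_stairM (k n : ℕ) : Continuous fun U : GaugeConfig 2 L G => stairM i j k n U := by
  induction n with
  | zero => simp only [stairM_zero]; exact continuous_const
  | succ n ih =>
    simp only [stairM_succ]
    split_ifs
    · exact ih.mul (continuous_cT _)
    · exact ih.mul (continuous_dT _)

/-- The plaquette terms are continuous. -/
theorem continuous_rr' (hρ : Continuous ρ) (y : Site 2 L) :
    Continuous fun U : GaugeConfig 2 L G => rr ρ i j U y :=
  (Complex.continuous_re.comp hρ.matrix_trace).comp ((continuous_cT y).mul (continuous_dT y).inv)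

variable [NeZero L]

/-- The far-layer weight is continuous. -/
theorem continuous_layerW (hρ : Continuous ρ) (β : ℝ) :
    Continuous fun U : GaugeConfig 2 L G => layerW ρ i j β U :=
  Real.continuous_exp.comp (continuous_const.mul
    (continuous_finsetSum _ fun y _ => continuous_rr' ρ hρ y))

omit [Group G] [IsTopologicalGroup G] [NeZero L] in
/-- The swap is continuous. -/
theorem continuous_configDiagSwap' : Continuous (configDiagSwap (G := G) (L := L) i j) :=
  continuous_pi fun _ => continuous_apply _

variable [CompactSpace G]

omit [IsTopologicalGroup G] [NeZero L] in
/-- The character of a continuous representation of a compact group is bounded. -/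
theorem exists_norm_trace_le (hρ : Continuous ρ) : ∃ C : ℝ, ∀ g : G, ‖(ρ g).trace‖ ≤ C := by
  obtain ⟨C, hC⟩ := isCompact_univ.exists_bound_of_continuousOn
    (hρ.matrix_trace.continuousOn (s := Set.univ))
  exact ⟨C, fun g => hC g (Set.mem_univ g)⟩

/-- The witness is bounded. -/
theorem exists_norm_stairWitness_le (hρ : Continuous ρ) (β : ℝ) :
    ∃ C : ℝ, ∀ U : GaugeConfig 2 L G, ‖stairWitness ρ i j β U‖ ≤ C := by
  obtain ⟨C, hC⟩ := exists_norm_trace_le ρ hρ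
  refine ⟨C * Real.exp (|β| * ((Sp (L := L) i j).card * N)), fun U => ?_⟩
  rw [stairWitness, norm_mul, Complex.norm_real, Real.norm_eq_abs, abs_of_pos (Real.exp_pos _)]
  refine mul_le_mul (hC _) (Real.exp_le_exp.2 ?_) (Real.exp_pos _).le
    ((norm_nonneg _).trans (hC (stairC i j L U)))
  calc -(β * ∑ y ∈ Sp i j, rr ρ i j U y) ≤ |β * ∑ y ∈ Sp i j, rr ρ i j U y| := neg_le_abs _
    _ = |β| * |∑ y ∈ Sp i j, rr ρ i j U y| := abs_mul _ _
    _ ≤ |β| * ((Sp (L := L) i j).card * N) :=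
        mul_le_mul_of_nonneg_left (abs_sum_rr_le ρ hρ i j _ U) (abs_nonneg β)

variable [MeasurableSpace G] [BorelSpace G] [SecondCountableTopology G]

omit [CompactSpace G] in
/-- The witness is measurable. -/
theorem measurable_stairWitness (hρ : Continuous ρ) (β : ℝ) :
    Measurable (stairWitness (L := L) ρ i j β) := by
  refine Measurable.mul ?_ ?_
  · exact (hρ.matrix_trace.comp (continuous_stairC (i := i) (j := j) L)).measurable
  · exact Complex.measurable_ofReal.comp
      ((Finset.measurable_sum _ fun y _ => measurable_rr ρ hρ i j y).const_mul β).neg.exp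

end Continuity

/-! ## The far layers do not read the mirror links -/

section Layer

variable {L N : ℕ} [NeZero L] {G : Type*} [Group G] (ρ : G →* Matrix (Fin N) (Fin N) ℂ) {i j : Fin 2}

omit [NeZero L] in
/-- A plaquette term does not read links outside its block. -/
theorem rr_update_of_not_mem_blk (U : GaugeConfig 2 L G) {e : Edge 2 L} {y : Site 2 L}
    (he : e ∉ blk i j y) (s : G) : rr ρ i j (Function.update U e s) y = rr ρ i j U y := by
  rw [mem_blk, not_or, not_or, not_or] at he
  obtain ⟨h1, h2, h3, h4⟩ := he
  simp only [rr, cT, dT, Function.update_of_ne (Ne.symm h1), Function.update_of_ne (Ne.symm h2),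
    Function.update_of_ne (Ne.symm h3), Function.update_of_ne (Ne.symm h4)]

/-- `kd y ≠ 0` and `kd y ± 1 ≠ 0` on the far layer `k = c` (`L ≥ 5`). -/
theorem kd_far_ne (h5 : 5 ≤ L) (hij : i ≠ j) {y : Site 2 L} (hy : y ∈ Sc i j) :
    kd i j y ≠ 0 ∧ kd i j (y.shift i) ≠ 0 ∧ kd i j (y.shift j) ≠ 0 := by
  rw [mem_Sc] at hy
  have h3 : 3 ≤ L := by omega
  refine ⟨fun h => ?_, fun h => ?_, fun h => ?_⟩
  · rw [h, ZMod.val_zero] at hy; omega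
  · rw [kd_shift_left hij] at h
    have hv : (kd i j y + 1).val = L / 2 + 1 := by
      rw [ZMod.val_add, val_one_of_three_le h3, hy]; exact Nat.mod_eq_of_lt (by omega)
    rw [h, ZMod.val_zero] at hv; omega
  · rw [kd_shift_right hij] at h
    have hv : (kd i j y - 1).val = L / 2 - 1 := by rw [val_sub_one_of_pos' h3 (by omega), hy]
    rw [h, ZMod.val_zero] at hv; omega

/-- The mirror `j`-link `(dg k, j)` is not a link of a far-layer plaquette (`L ≥ 5`). -/
theorem dgj_not_mem_blk_far (h5 : 5 ≤ L) (hij : i ≠ j) {y : Site 2 L} (hy : y ∈ Sc i j) (k : ℕ) :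
    ((dg k, j) : Edge 2 L) ∉ blk i j y := by
  obtain ⟨h0, hi, -⟩ := kd_far_ne h5 hij hy
  simp only [mem_blk, Prod.mk.injEq, not_or]
  exact ⟨fun h => hij h.2.symm, fun h => hi (by rw [← h.1, kd_dg]), fun h => h0 (by rw [← h.1, kd_dg]),
    fun h => hij h.2.symm⟩

/-- The mirror `i`-link `(dg k, i)` is not a link of a far-layer plaquette (`L ≥ 5`). -/
theorem dgi_not_mem_blk_far (h5 : 5 ≤ L) (hij : i ≠ j) {y : Site 2 L} (hy : y ∈ Sc i j) (k : ℕ) :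
    ((dg k, i) : Edge 2 L) ∉ blk i j y := by
  obtain ⟨h0, -, hj⟩ := kd_far_ne h5 hij hy
  simp only [mem_blk, Prod.mk.injEq, not_or]
  exact ⟨fun h => h0 (by rw [← h.1, kd_dg]), fun h => hij h.2, fun h => hij h.2,
    fun h => hj (by rw [← h.1, kd_dg])⟩

variable [TopologicalSpace G]

omit [TopologicalSpace G] in
/-- The far-layer weight does not read the mirror `j`-links (`L ≥ 5`). -/
theorem layerW_update_dgj (h5 : 5 ≤ L) (hij : i ≠ j) (β : ℝ) (U : GaugeConfig 2 L G) (k : ℕ)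
    (s : G) : layerW ρ i j β (Function.update U (dg k, j) s) = layerW ρ i j β U := by
  unfold layerW
  rw [Finset.sum_congr rfl fun y hy => rr_update_of_not_mem_blk ρ U (dgj_not_mem_blk_far h5 hij hy k) s]

omit [NeZero L] [Group G] [TopologicalSpace G] in
/-- The swap of an updated configuration is the update of the swap at the swapped link. -/
theorem configDiagSwap_update (U : GaugeConfig 2 L G) (e : Edge 2 L) (s : G) :
    configDiagSwap i j (Function.update U e s) =
      Function.update (configDiagSwap i j U) (edgeDiagSwap i j e) s := by
  funext e'
  by_cases h : e' = edgeDiagSwap i j e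
  · subst h
    rw [Function.update_self, configDiagSwap, edgeDiagSwap_edgeDiagSwap, Function.update_self]
  · have h' : edgeDiagSwap i j e' ≠ e := fun h' => h (by rw [← h', edgeDiagSwap_edgeDiagSwap])
    rw [Function.update_of_ne h, configDiagSwap, configDiagSwap, Function.update_of_ne h']

omit [NeZero L] in
/-- The swap of the mirror `j`-link is the mirror `i`-link. -/
theorem edgeDiagSwap_dgj (k : ℕ) : edgeDiagSwap i j ((dg k, j) : Edge 2 L) = (dg k, i) := by
  simp [edgeDiagSwap, Equiv.swap_apply_right]

omit [TopologicalSpace G] in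
/-- The swapped far-layer weight does not read the mirror `j`-links either (`L ≥ 5`). -/
theorem layerW_configDiagSwap_update_dgj (h5 : 5 ≤ L) (hij : i ≠ j) (β : ℝ) (U : GaugeConfig 2 L G)
    (k : ℕ) (s : G) :
    layerW ρ i j β (configDiagSwap i j (Function.update U (dg k, j) s)) =
      layerW ρ i j β (configDiagSwap i j U) := by
  rw [configDiagSwap_update, edgeDiagSwap_dgj]
  unfold layerW
  rw [Finset.sum_congr rfl fun y hy =>
    rr_update_of_not_mem_blk ρ (configDiagSwap i j U) (dgi_not_mem_blk_far h5 hij hy k) s]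

end Layer

/-! ## The one-link identity -/

section OneLink

variable {N : ℕ} {G : Type*} [Group G] [TopologicalSpace G] [IsTopologicalGroup G] [CompactSpace G]
  [MeasurableSpace G] [BorelSpace G] (ρ : G →* Matrix (Fin N) (Fin N) ℂ)

/-- ★ **The one-link identity**: for a continuous weight `w` with
`wAvg ρ w = c • 1` and all `X u Y C ∈ G`,
`∫ conj tr ρ(X (s u) Y) · w(C (s u)⁻¹) ds = c · conj tr ρ(X C Y)`. -/
theorem integral_conj_trace_mul_weight (hρ : Continuous ρ) {w : G → ℝ} (hw : Continuous w)
    {c : ℝ}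
    (hc : TwistedSlab.wAvg ρ w = ((c : ℂ)) • (1 : Matrix (Fin N) (Fin N) ℂ)) (X u Y C : G) :
    ∫ s, (starRingEnd ℂ) ((ρ (X * (s * u) * Y)).trace) * (w (C * (s * u)⁻¹) : ℂ) ∂(haarProbability G) =
      (c : ℂ) * (starRingEnd ℂ) ((ρ (X * C * Y)).trace) := by
  -- (1) `s ↦ s u⁻¹`
  have h1 := integral_mul_right_eq_self (μ := haarProbability G)
    (fun s => (starRingEnd ℂ) ((ρ (X * (s * u) * Y)).trace) * (w (C * (s * u)⁻¹) : ℂ)) u⁻¹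
  simp only [inv_mul_cancel_right] at h1
  rw [← h1]
  -- (2) `s ↦ s⁻¹`
  have h2 := integral_inv_eq_self (fun s : G => (starRingEnd ℂ) ((ρ (X * s * Y)).trace) * (w (C * s⁻¹) : ℂ))
    (haarProbability G)
  simp only [inv_inv] at h2
  rw [← h2]
  -- (3) `s ↦ C⁻¹ s`
  have h3 := integral_mul_left_eq_self (μ := haarProbability G)
    (fun s : G => (starRingEnd ℂ) ((ρ (X * s⁻¹ * Y)).trace) * (w (C * s) : ℂ)) C⁻¹
  simp only [mul_inv_rev, inv_inv, mul_inv_cancel_left] at h3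
  rw [← h3]
  -- (4) conjugate traces are traces of inverses; cyclicity
  have h4 : ∀ s : G, (starRingEnd ℂ) ((ρ (X * (s⁻¹ * C) * Y)).trace) * (w s : ℂ) =
      (w s : ℂ) * (ρ (s * (X⁻¹ * Y⁻¹ * C⁻¹))).trace := by
    intro s
    have e1 : (X * (s⁻¹ * C) * Y)⁻¹ = (Y⁻¹ * C⁻¹) * (s * (X⁻¹ * Y⁻¹ * C⁻¹)) * (Y⁻¹ * C⁻¹)⁻¹ := by
      group
    rw [← CompactGroup.trace_map_inv ρ hρ, e1, CompactGroup.trace_conj_eq, mul_comm]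
  simp_rw [h4]
  rw [DiagRP.integral_weight_mul_trace_mul ρ hw hρ hc, ← CompactGroup.trace_map_inv ρ hρ]
  have e2 : (X * C * Y)⁻¹ = X * (X⁻¹ * Y⁻¹ * C⁻¹) * X⁻¹ := by group
  rw [e2, CompactGroup.trace_conj_eq]

end OneLink

end DiagRPTwo

end

end Summit.QuantumFields.GaugeBoot
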